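import Summits.BirchSwinnertonDyer.Rank1Residual.X10.BeyondCarrierResidualOfTwins
import HarnessLib

/-!
# Crux `BeyondCarrierDepthX10b` (stmt-BirchSwinnertonDyer-23055) through the one-sided link U₃ —
# bookkeeping: U₃ at a datum IS the co-STEP-L inequality given control, the two-sided link implies it,
# and on the `3 ∤ h_K` frames U₃ is PRINT modulo the cell's cite-only facts `h46` / `hYZ` / `h331`

HONEST FRAMING (cell `run/shared/lean/pub/bsd-print-x9/`, D-0154 row 10 width seat `bsd-line-x10b-p1-w2`;
companion of `Theorems/PrintX10bBeyondCarrierDepthOfUpperLink.lean`, which derives the crux 23055 and its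
parent J₃ 21340 BY NAME from U₃ + `h331` / `hChaL` / `hKo`): THEOREMS ONLY, route-free (no `Theses`
import), nothing booked, nothing closed. «beyond-print theorem»: NO. BSD is not proved by any of this.

U₃ at an anticyclotomic datum `(κ, 𝔭, γ, ι)` and a point `P ∈ E(K)` is the ONE-SIDED link

  `∃ n, XAc.HasCharValuationAt (E_K) p κ 𝔭 ∅ γ n ∧ n ≤ 2·(ord_p log_ω P + ord_p(1 − a_p + p) − 1)`,

`ord_p f_ac(0) ≤ ord_p L_p^{BDP}(𝟙)` read through Castella 2018 Thm. 3.2 — the divisibility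
`(L_p^{BDP}(𝟙)) ⊆ (f_ac(0))`, the EULER-SYSTEM («Selmer is small») direction of the BDP / Heegner-point
main conjecture at the trivial character; the mirror of the tree's `X11b.IMCLowerWaldspurgerOnTreeGoodAt`.

WHAT.
* `upperLink_of_imcWaldspurgerOnTreeGoodAt` — the EQUALITY form `X11b.IMCWaldspurgerOnTreeGoodAt` gives U₃
  at the datum (mirror of `X11b.imcLowerWaldspurgerOnTreeGoodAt_of_imcWaldspurgerOnTreeGoodAt`).
* `upperLink_iff_shaTamagawa_le_of_control_of_allSplit` — GIVEN (CTL)ᵍ at the datum (JSW Thm. 3.3.1's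
  shape `X11b.ControlOnTreeGoodAt`), a classical Heegner field and `Ш(E/K)` finite, U₃ at the datum ⟺
  `ord_p #Ш(E/K) + 2·ord_p ∏_ℓ c_ℓ(E) ≤ 2·ord_p [E(K):ℤP]` (= `SchneiderFree.Upper.IndexUpperBoundLeAt W p K P 0`,
  co-STEP L): so U₃ is not merely sufficient for the J₃ argument but EXACTLY its analytic input (mirror of
  `X11b.imcLowerWaldspurgerOnTreeGoodAt_iff_indexLowerBoundAt_of_allSplit`).
* `upperLinkX10b_coprimeClassNumber_of_namedFacts (h46) (hYZ) (h331)` — U₃ on the X10b frames of B₃ WITH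
  `3 ∤ h_K` is PRINT modulo the cite-only facts: Mastella–Zerman 2026 Cor. 4.6 at `3` (`h46`, Howard's
  containment via `X10.heegnerContainment_of_cor46_of_not_surj`) + the Yan–Zhu/BCS/CGLS composite (`hYZ`)
  + JSW Thm. 3.3.1 (`h331`) give the EQUALITY (`X11b.imcWaldspurgerOnTreeGoodAt_inducedPlace_of_heegnerContainment_of_thm331`,
  p4), hence U₃. CONSEQUENCE for the planner (numbers): U₃ = U₃[3 ∤ h_K] (print modulo 3 cite-only facts,
  this file) ∧ U₃[3 ∣ h_K] (ONE one-sided statement, beyond print at `p = 3` — no Literature fact states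
  the Euler-system divisibility of the BDP / Heegner-point main conjecture integrally at `p ∣ h_K`: Howard
  2004 / Mastella–Zerman 2026 assume `p ∤ h_K`, CGLS 2022 Thm. 4.1.3 is in `Λ[1/p]`, BCK 2021 Thm. 5.2 has
  `p > 3`, Castella–Hsieh 2018 Thms. A–B are rank statements at finite level).

References: [Castella2018] Thm. 2.3, Thm. 3.2, §5; [JetchevSkinnerWan2017] Thm. 3.3.1, §7.3.1 (eq:tamK),
§7.4.1; [MastellaZerman2026] Cor. 4.6; [YanZhu2024MainConjNonCM] Thm. 5.7 (1), 5.9;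
[BurungaleCastellaSkinner2025] Prop. 4.2.2; [CastellaGrossiLeeSkinner2022] Thm. 4.1.3, Thm. 5.1.3;
[BurungaleCastellaKim2021] Thm. 5.2; [CastellaHsieh2018] Thms. A–B; [Howard2004HeegnerKolyvagin] Thm. B.
-/

-- the REGISTERED stub namespace `Summit.BirchSwinnertonDyer.BirchSwinnertonDyer.Cruxes.…` repeats the summit name
set_option linter.dupNamespace false
set_option autoImplicit false

noncomputable section

open scoped Classical MatrixGroups ModularForm

open CongruenceSubgroup WeierstrassCurve NumberField IsDedekindDomain
  Literature.NumberTheory.EllipticCurves Literature.NumberTheory.EllipticCurves.ModularForms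
  Literature.NumberTheory.EllipticCurves.JetchevSkinnerWan2017
  Literature.NumberTheory.EllipticCurves.YanZhu2026
  Summit.BirchSwinnertonDyer.BirchSwinnertonDyer.Theorems.Rank1ResidualX1Defs
  Summit.BirchSwinnertonDyer.Rank1Residual
  Summit.BirchSwinnertonDyer.Rank1Residual.X11b.Three.Koly
  Summit.BirchSwinnertonDyer.Rank1Residual.X11b.KolyvaginBottom
  Summit.BirchSwinnertonDyer.BirchSwinnertonDyer.Rank1Residual

open Literature.NumberTheory.EllipticCurves.Rank1Residual (ClassX10 Surj)

namespace Summit.BirchSwinnertonDyer.BirchSwinnertonDyer.Cruxes.BeyondCarrierDepthX10b.UpperHalf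

section Datum

variable {W : WeierstrassCurve ℚ} [W.IsElliptic] [W.IsGloballyMinimal] {K : Type} [Field K] [NumberField K]
  {p : ℕ} [Fact p.Prime] {κ : ZpExtension K p} {𝔭 : IsDedekindDomain.HeightOneSpectrum (𝓞 K)}
  {γ : Field.absoluteGaloisGroup K} [Fact (κ.IsTopGenerator γ)] {ι : K →+* ℚ_[p]}
  {P : (W.baseChange K).toAffine.Point}

/-- **The two-sided link gives the one-sided one**: the EQUALITY `ord_p f_ac(0) = 2·(ord_p log_ω P +
ord_p(1 − a_p + p) − 1)` (`X11b.IMCWaldspurgerOnTreeGoodAt`, IMC∘Waldspurger at `𝟙`) implies U₃ at the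
datum (its `≤` half). Mirror of `X11b.imcLowerWaldspurgerOnTreeGoodAt_of_imcWaldspurgerOnTreeGoodAt`.
[cite: Castella2018, §5 (eq:IMC+BDP)] -/
theorem upperLink_of_imcWaldspurgerOnTreeGoodAt (h : X11b.IMCWaldspurgerOnTreeGoodAt p κ 𝔭 γ ι P) :
    ∃ n : ℕ, X11b.AcSelmer.XAc.HasCharValuationAt (W.baseChange K) p κ 𝔭 ∅ γ n ∧
      (n : ℤ) ≤ 2 * (X11b.padicLogOrd W p ι P + (padicValInt p (1 - W.frobeniusTrace p + p) : ℤ) - 1) := by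
  obtain ⟨n, hn, heq⟩ := h
  exact ⟨n, hn, le_of_eq heq⟩

/-- **Given (CTL)ᵍ at the datum, U₃ at the datum IS co-STEP L** — over a classical Heegner field (every
`ℓ ∣ N_E` split) with `Ш(E/K)` finite: `(∃ n, ord_p f_ac(0) = n ∧ n ≤ 2·(ord_p log_ω P + ord_p(1 − a_p + p)
− 1)) ⟺ ord_p #Ш(E/K) + 2·ord_p ∏_ℓ c_ℓ(E) ≤ 2·ord_p [E(K):ℤP]`. The anomaly term cancels against the
control identity; Tamagawa transport `ord_p ∏_{w∣N⁺} c_w = ord_p ∏_w c_w(E/K) = 2·ord_p ∏_ℓ c_ℓ`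
(`X11b.padicValNat_tamagawa_of_heegner_anyPrime`, every `p`); `ord_p #Ш[p^∞] = ord_p #Ш` for finite `Ш`.
Mirror of `X11b.imcLowerWaldspurgerOnTreeGoodAt_iff_indexLowerBoundAt_of_allSplit`.
[cite: JetchevSkinnerWan2017, Thm. 3.3.1, §7.3.1 (eq:tamK), §7.4.1] [cite: Castella2018, Thm. 2.3, Thm. 3.2] -/
theorem upperLink_iff_shaTamagawa_le_of_control_of_allSplit (hK : IsImaginaryQuadratic K) {N : ℕ}
    (hN : W.conductorNorm ℤ = N) (hH : SatisfiesHeegnerHypothesis N K) [Finite (W.baseChange K).sha]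
    (hCTL : X11b.ControlOnTreeGoodAt p κ 𝔭 γ ι P) :
    (∃ n : ℕ, X11b.AcSelmer.XAc.HasCharValuationAt (W.baseChange K) p κ 𝔭 ∅ γ n ∧
      (n : ℤ) ≤ 2 * (X11b.padicLogOrd W p ι P + (padicValInt p (1 - W.frobeniusTrace p + p) : ℤ) - 1)) ↔
    padicValNat p (W.baseChange K).shaOrder + 2 * padicValNat p W.tamagawaProduct ≤
      2 * padicValNat p (AddSubgroup.zmultiples P).index := by
  haveI : Finite (AddCommGroup.primaryComponent (W.baseChange K).sha p) :=
    Finite.of_injective _ Subtype.val_injective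
  obtain ⟨h1, h2⟩ := X11b.padicValNat_tamagawa_of_heegner_anyPrime (W := W) p hK hN hH
  obtain ⟨n', hn', hne'⟩ := hCTL
  rw [h1, h2, padicValNat_card_addPrimaryComponent (A := (W.baseChange K).sha) p] at hne'
  rw [WeierstrassCurve.shaOrder]
  constructor
  · rintro ⟨n, hn, hle⟩
    obtain rfl : n = n' := hn.unique hn'
    omega
  · intro h
    exact ⟨n', hn', by omega⟩

end Datum

/-- **U₃ on the `3 ∤ h_K` frames is PRINT modulo three cite-only facts.** On every frame of B₃ (non-CM X10b
pair: `p = 3`, `E[3]` irreducible, `ρ̄_{E,3}` not onto; `K` imaginary quadratic with odd `d_K ≠ −3`,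
Heegner for `N_E` and `3`, (irr_K); anticyclotomic datum `(ι, κ, γ)`; Manin-good `Dt`; `P = y_K` of
infinite order; `rank_ℤ E(K) = 1`, `Ш[3^∞]` finite) WITH `3 ∤ h_K`: Mastella–Zerman 2026 Cor. 4.6 at `3`
(`h46`: Howard's containment, `X10.heegnerContainment_of_cor46_of_not_surj`) + the Yan–Zhu/BCS/CGLS composite
(`hYZ`) + JSW 2017 Thm. 3.3.1 (`h331`) give the two-sided link at the datum
(`X11b.imcWaldspurgerOnTreeGoodAt_inducedPlace_of_heegnerContainment_of_thm331`, p4), hence its `≤` half U₃.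
What is NOT covered: the same statement with `3 ∣ h_K` — the one open one-sided input of crux 23055 / J₃.
[cite: MastellaZerman2026, Cor. 4.6] [cite: YanZhu2024MainConjNonCM, Thm. 5.7 (1), Thm. 5.9]
[cite: BurungaleCastellaSkinner2025, Prop. 4.2.2] [cite: CastellaGrossiLeeSkinner2022, Thm. 5.1.3]
[cite: JetchevSkinnerWan2017, Thm. 3.3.1] [cite: Castella2018, §5 (eq:IMC+BDP)] -/
theorem upperLinkX10b_coprimeClassNumber_of_namedFacts
    (h46 : MastellaZerman2026.cor46_howardDivisibility_of_scalarImage.{0})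
    (hYZ : thm57_thm59_bcs422_cgls513_generator_constantCoeff_of_heegnerDivisibility)
    (h331 : thm331_anticyclotomicControl) :
    ∀ (W : WeierstrassCurve ℚ) [W.IsElliptic] [W.IsGloballyMinimal] (p : ℕ) [Fact p.Prime]
    [NeZero (W.conductorNorm ℤ)] (K : Type) [Field K] [NumberField K],
    Literature.NumberTheory.EllipticCurves.Rank1Residual.ClassX10 W p →
    ¬ Literature.NumberTheory.EllipticCurves.Rank1Residual.Surj W 3 → ¬ W.HasCM →
    Literature.NumberTheory.EllipticCurves.IsImaginaryQuadratic K → Odd (NumberField.discr K) →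
    NumberField.discr K ≠ -3 →
    Literature.NumberTheory.EllipticCurves.SatisfiesHeegnerHypothesis (W.conductorNorm ℤ) K →
    Literature.NumberTheory.EllipticCurves.SatisfiesHeegnerHypothesis p K →
    (W.baseChange K).HasIrreducibleModPGaloisRep p → ¬ p ∣ NumberField.classNumber K →
    ∀ (ι : K →+* ℚ_[p]) (κ : Literature.NumberTheory.EllipticCurves.ZpExtension K p), κ.IsAnticyclotomic →
    ∀ (γ : Field.absoluteGaloisGroup K) [Fact (κ.IsTopGenerator γ)]
      (Dt : Literature.NumberTheory.EllipticCurves.ModularForms.ModularParametrizationData W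
        (W.conductorNorm ℤ)), ¬ (p : ℤ) ∣ Dt.c →
    ∀ (H : Literature.NumberTheory.EllipticCurves.HeegnerDatum (W.conductorNorm ℤ) (NumberField.discr K))
      (ιC : K →+* ℂ) (P : (W.baseChange K).toAffine.Point),
      WeierstrassCurve.Affine.Point.map ιC.toRatAlgHom P =
        Literature.NumberTheory.EllipticCurves.ModularForms.heegnerPointComplex Dt H →
      (W.baseChange K).mordellWeilRank = 1 →
      Finite (AddCommGroup.primaryComponent (W.baseChange K).sha p) → ¬ IsOfFinAddOrder P →
    ∃ n : ℕ, Summit.BirchSwinnertonDyer.Rank1Residual.X11b.AcSelmer.XAc.HasCharValuationAt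
        (W.baseChange K) p κ (Summit.BirchSwinnertonDyer.Rank1Residual.X11b.inducedPlace ι) ∅ γ n ∧
      (n : ℤ) ≤ 2 * (Summit.BirchSwinnertonDyer.Rank1Residual.X11b.padicLogOrd W p ι P +
        (padicValInt p (1 - W.frobeniusTrace p + p) : ℤ) - 1) := by
  intro W _ _ p _ _ K _ _ hX hns hcm hK hodd h3 hHN hHp hirrK hhK ι κ hκ γ _ Dt hc H ιC P hP hrk hfinp hPinf
  obtain ⟨hp3, hord, hirr, -⟩ := id hX
  subst hp3
  have h4 : NumberField.discr K ≠ -4 := by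
    rintro h
    rw [h] at hodd
    exact absurd hodd (by decide)
  -- Howard's containment at the frame from Mastella–Zerman Cor. 4.6 at `3` (needs `3 ∤ h_K`)
  have hHow := X10.heegnerContainment_of_cor46_of_not_surj h46 hX hns hcm hK h3 h4 hHN hHp hhK κ hκ γ
    Fact.out Dt H ιC
  -- the two-sided link at the induced place from the composite + JSW (needs `3 ∤ h_K`), then its `≤` half
  exact upperLink_of_imcWaldspurgerOnTreeGoodAt
    (X11b.imcWaldspurgerOnTreeGoodAt_inducedPlace_of_heegnerContainment_of_thm331 hYZ h331 le_rfl hord hK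
      hodd h3 rfl hHN hHp hirrK hhK ι κ hκ γ Dt hc H ιC P hP hrk hfinp hPinf hHow)

end Summit.BirchSwinnertonDyer.BirchSwinnertonDyer.Cruxes.BeyondCarrierDepthX10b.UpperHalf

end
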